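import Mathlib.RingTheory.Valuation.ValuationSubring
import Mathlib.LinearAlgebra.FiniteDimensional.Lemmas
import Mathlib.LinearAlgebra.Pi
import Mathlib.RingTheory.LocalRing.ResidueField.Basic
import HarnessLib

/-!
# Echelon bases: the integral points of a subspace over a valuation subring

Let `O ⊆ C` be a valuation subring of a field `C` (no Noetherian hypothesis: e.g. `ℤ̄_p ⊆ ℚ̄_p`)
with maximal ideal `𝔪` and residue field `k`, and let `W ⊆ Cʳ` be a `C`-subspace.  The module of
**integral points** `W ∩ Oʳ` is a FREE `O`-module with an "echelon" basis: there are integral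
points `t₁, …, t_n` of `W` whose reductions modulo `𝔪` are linearly independent over `k` and
which generate all integral points over `O` (`exists_echelonFamily`).  THEOREMS ONLY.  Consequences
of the independence of the reductions (for any such family): independence over `O`
(`linearIndependent_of_linearIndependent_residue`) and over `C`
(`linearIndependent_field_of_linearIndependent_residue`), and saturation — a combination with all
coordinates in `𝔪` has all coefficients in `𝔪` (`mem_maximalIdeal_of_forall_sum_mem`).  This is
the linear algebra used to build finite free `ℤ̄_p`-lattices with good reduction inside spaces of
modular forms (Deligne–Serre-type lifting over `ℚ̄_p`).

Proof (Gaussian elimination with pivots of maximal valuation): if `W ≠ 0`, a non-zero `w ∈ W`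
divided by a coordinate of largest valuation is an integral point `t₁` with a coordinate `j₀`
equal to `1`; every integral point `s` splits as `s(j₀) t₁ + s'` with `s'` an integral point of
`W' = W ∩ {x_{j₀} = 0}`, of smaller dimension; induct.  Over a principal ideal domain this is the
Smith normal form (`Literature.LinearAlgebra.exists_integral_basis_linearIndependent_quotient`);
over a general valuation ring the finite generation itself is the point. [folklore]
-/

noncomputable section

namespace Literature.LinearAlgebra

open Module IsLocalRing

variable {C : Type*} [Field C] (O : ValuationSubring C) {r : ℕ}

/-- Rescaling by a coordinate of maximal valuation: a non-zero vector `c ∈ Cⁿ` has an index `i₀`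
with `c i₀ ≠ 0` and all `c i / c i₀ ∈ O`. [folklore] -/
theorem exists_div_mem {n : ℕ} {c : Fin n → C} (hc : c ≠ 0) :
    ∃ i₀, c i₀ ≠ 0 ∧ ∀ i, (c i₀)⁻¹ * c i ∈ O := by
  obtain ⟨i₁, hi₁⟩ : ∃ i, c i ≠ 0 := by
    by_contra h
    push Not at h
    exact hc (funext h)
  obtain ⟨i₀, -, hi₀⟩ :=
    Finset.exists_max_image Finset.univ (fun i ↦ O.valuation (c i)) ⟨i₁, Finset.mem_univ _⟩
  have hci₀ : c i₀ ≠ 0 := by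
    intro h0
    have h1 := hi₀ i₁ (Finset.mem_univ _)
    rw [h0, Valuation.map_zero, le_zero_iff, Valuation.zero_iff] at h1
    exact hi₁ h1
  refine ⟨i₀, hci₀, fun i ↦ O.mem_of_valuation_le_one _ ?_⟩
  rw [Valuation.map_mul, map_inv₀]
  have hv0 : O.valuation (c i₀) ≠ 0 := fun h ↦ hci₀ ((Valuation.zero_iff _).mp h)
  calc (O.valuation (c i₀))⁻¹ * O.valuation (c i)
      ≤ (O.valuation (c i₀))⁻¹ * O.valuation (c i₀) := by
        gcongr; exact hi₀ i (Finset.mem_univ _)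
    _ = 1 := inv_mul_cancel₀ hv0

/-- **A non-zero subspace has an integral point with a coordinate equal to `1`**: divide a
non-zero vector by a coordinate of maximal valuation. [folklore] -/
theorem exists_integral_apply_eq_one {W : Submodule C (Fin r → C)} (hW : W ≠ ⊥) :
    ∃ t : Fin r → O, (fun j ↦ (t j : C)) ∈ W ∧ ∃ j₀ : Fin r, t j₀ = 1 := by
  obtain ⟨w, hwW, hw0⟩ := Submodule.exists_mem_ne_zero_of_ne_bot hW
  obtain ⟨j₀, hwj₀, hmem⟩ := exists_div_mem O hw0
  refine ⟨fun j ↦ ⟨(w j₀)⁻¹ * w j, hmem j⟩, ?_, j₀, Subtype.ext (inv_mul_cancel₀ hwj₀)⟩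
  have h : (fun j ↦ (((⟨(w j₀)⁻¹ * w j, hmem j⟩ : O)) : C)) = (w j₀)⁻¹ • w := by
    funext j; rfl
  rw [h]
  exact W.smul_mem _ hwW

/-- **Echelon families of integral points.**  For a valuation subring `O` of a field `C` and a
subspace `W ⊆ Cʳ` there are finitely many integral points `t₁, …, t_n ∈ W ∩ Oʳ` whose reductions
modulo the maximal ideal are linearly independent over the residue field and which generate the
`O`-module of all integral points of `W`. [folklore] -/
theorem exists_echelonFamily (W : Submodule C (Fin r → C)) :
    ∃ (n : ℕ) (t : Fin n → Fin r → O),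
      (∀ i, (fun j ↦ (t i j : C)) ∈ W) ∧
      LinearIndependent (ResidueField O) (fun i j ↦ residue O (t i j)) ∧
      ∀ s : Fin r → O, (fun j ↦ (s j : C)) ∈ W → s ∈ Submodule.span O (Set.range t) := by
  -- strong induction on the dimension of `W`
  suffices h : ∀ (d : ℕ) (W : Submodule C (Fin r → C)), finrank C W = d →
      ∃ (n : ℕ) (t : Fin n → Fin r → O),
        (∀ i, (fun j ↦ (t i j : C)) ∈ W) ∧
        LinearIndependent (ResidueField O) (fun i j ↦ residue O (t i j)) ∧
        ∀ s : Fin r → O, (fun j ↦ (s j : C)) ∈ W → s ∈ Submodule.span O (Set.range t) from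
    h _ W rfl
  intro d
  induction d using Nat.strong_induction_on with
  | _ d ih =>
  intro W hd
  by_cases hW : W = ⊥
  · -- `W = 0`: the only integral point is `0`
    subst hW
    refine ⟨0, Fin.elim0, fun i ↦ Fin.elim0 i, linearIndependent_empty_type, fun s hs ↦ ?_⟩
    rw [Submodule.mem_bot] at hs
    have : s = 0 := by
      funext j
      exact Subtype.ext (congrFun hs j)
    rw [this]
    exact Submodule.zero_mem _
  · -- the pivot `t₁` with `t₁ j₀ = 1`, and the smaller subspace `W' = W ∩ {x_{j₀} = 0}`
    obtain ⟨t₁, ht₁, j₀, hj₀⟩ := exists_integral_apply_eq_one O hW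
    set W' : Submodule C (Fin r → C) := W ⊓ LinearMap.ker (LinearMap.proj j₀) with hW'
    have hmemW' : ∀ s : Fin r → O, (fun j ↦ (s j : C)) ∈ W' ↔
        (fun j ↦ (s j : C)) ∈ W ∧ s j₀ = 0 := fun s ↦ by
      rw [hW', Submodule.mem_inf, LinearMap.mem_ker, LinearMap.proj_apply]
      exact ⟨fun h ↦ ⟨h.1, by exact_mod_cast h.2⟩, fun h ↦ ⟨h.1, by exact_mod_cast h.2⟩⟩
    have hlt : W' < W := by
      refine lt_of_le_of_ne inf_le_left fun h ↦ ?_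
      have h1 : (fun j ↦ (t₁ j : C)) ∈ W' := h.symm ▸ ht₁
      have h2 := ((hmemW' t₁).mp h1).2
      rw [hj₀] at h2
      exact one_ne_zero h2
    haveI : FiniteDimensional C W := FiniteDimensional.finiteDimensional_submodule W
    have hd' : finrank C W' < d := hd ▸ Submodule.finrank_lt_finrank_of_lt hlt
    obtain ⟨n', t', ht'mem, ht'li, ht'span⟩ := ih _ hd' W' rfl
    have ht'j₀ : ∀ i, t' i j₀ = 0 := fun i ↦ ((hmemW' (t' i)).mp (ht'mem i)).2
    -- the family `t = (t₁, t')`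
    let t : Fin (n' + 1) → Fin r → O := Fin.cons t₁ t'
    have ht0 : t 0 = t₁ := rfl
    have hts : ∀ i : Fin n', t i.succ = t' i := fun i ↦ by simp [t]
    refine ⟨n' + 1, t, ?_, ?_, ?_⟩
    · refine Fin.cases (by rw [ht0]; exact ht₁) (fun i ↦ ?_)
      rw [hts]
      exact (inf_le_left : W' ≤ W) (ht'mem i)
    · -- independence of the reductions: look at the coordinate `j₀` first
      rw [Fintype.linearIndependent_iff]
      intro g hg
      have hg0 : g 0 = 0 := by
        have h := congrFun hg j₀
        rw [Finset.sum_apply, Fin.sum_univ_succ, Pi.zero_apply] at h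
        simp only [Pi.smul_apply, ht0, hts, hj₀, map_one, ht'j₀, map_zero, smul_eq_mul, mul_one,
          mul_zero, Finset.sum_const_zero, add_zero] at h
        exact h
      have hrest : ∑ i : Fin n', g i.succ • (fun j ↦ residue O (t' i j)) = 0 := by
        rw [Fin.sum_univ_succ, hg0, zero_smul, zero_add] at hg
        simpa only [hts] using hg
      have hg' := (Fintype.linearIndependent_iff.mp ht'li) (fun i ↦ g i.succ) hrest
      intro i
      exact Fin.cases hg0 (fun i ↦ hg' i) i
    · -- generation: `s - s(j₀) t₁` is an integral point of `W'`
      intro s hs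
      have hs' : (fun j ↦ ((s - s j₀ • t₁) j : C)) ∈ W' := by
        rw [hmemW']
        refine ⟨?_, ?_⟩
        · have h : (fun j ↦ ((s - s j₀ • t₁) j : C)) =
              (fun j ↦ (s j : C)) - (s j₀ : C) • (fun j ↦ (t₁ j : C)) := by
            funext j
            simp [Algebra.smul_def]
          rw [h]
          exact W.sub_mem hs (W.smul_mem _ ht₁)
        · simp [hj₀]
      have h1 := ht'span _ hs'
      have h2 : Submodule.span O (Set.range t') ≤ Submodule.span O (Set.range t) := by
        refine Submodule.span_mono ?_
        rintro _ ⟨i, rfl⟩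
        exact ⟨i.succ, hts i⟩
      have h3 : s = s j₀ • t 0 + (s - s j₀ • t₁) := by rw [ht0]; abel
      rw [h3]
      exact Submodule.add_mem _ (Submodule.smul_mem _ _ (Submodule.subset_span ⟨0, rfl⟩)) (h2 h1)

/-- **Independence over `O` from independence of the reductions** (rescale a putative relation by
a coefficient of maximal valuation and reduce). [folklore] -/
theorem linearIndependent_of_linearIndependent_residue {n : ℕ} {t : Fin n → Fin r → O}
    (hli : LinearIndependent (ResidueField O) (fun i j ↦ residue O (t i j))) :
    LinearIndependent O t := by
  rw [Fintype.linearIndependent_iff]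
  intro c hc
  by_contra hne
  push Not at hne
  have hc0 : (fun i ↦ (c i : C)) ≠ 0 := by
    obtain ⟨i₁, hi₁⟩ := hne
    intro h
    exact hi₁ (Subtype.ext (congrFun h i₁))
  obtain ⟨i₀, hci₀, hmem⟩ := exists_div_mem O hc0
  let c' : Fin n → O := fun i ↦ ⟨((c i₀ : C))⁻¹ * c i, hmem i⟩
  have hc'i₀ : c' i₀ = 1 := Subtype.ext (inv_mul_cancel₀ hci₀)
  -- `∑ c' i • t i = 0`: multiply the relation by `(c i₀)⁻¹` inside `C`
  have hrel : ∑ i, c' i • t i = 0 := by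
    funext j
    apply Subtype.ext
    have h := congrArg (fun v : Fin r → O ↦ ((c i₀ : C))⁻¹ * (v j : C)) hc
    simp only [Finset.sum_apply, Pi.smul_apply, smul_eq_mul, Pi.zero_apply] at h ⊢
    push_cast at h ⊢
    rw [mul_zero, Finset.mul_sum] at h
    rw [← h]
    refine Finset.sum_congr rfl fun i _ ↦ ?_
    simp only [c']
    ring
  -- reduce modulo the maximal ideal
  have hred : ∑ i, residue O (c' i) • (fun j ↦ residue O (t i j)) = 0 := by
    have h := congrArg (fun v : Fin r → O ↦ fun j ↦ residue O (v j)) hrel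
    simp only [Finset.sum_apply, Pi.smul_apply, smul_eq_mul, map_sum, map_mul, Pi.zero_apply,
      map_zero] at h
    funext j
    simpa [Finset.sum_apply] using congrFun h j
  have h0 := (Fintype.linearIndependent_iff.mp hli) _ hred i₀
  rw [hc'i₀, map_one] at h0
  exact one_ne_zero h0

/-- **Independence over the field `C` from independence of the reductions.** [folklore] -/
theorem linearIndependent_field_of_linearIndependent_residue {n : ℕ} {t : Fin n → Fin r → O}
    (hli : LinearIndependent (ResidueField O) (fun i j ↦ residue O (t i j))) :
    LinearIndependent C (fun i j ↦ (t i j : C)) := by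
  rw [Fintype.linearIndependent_iff]
  intro c hc
  by_contra hne
  push Not at hne
  have hc0 : c ≠ 0 := by
    obtain ⟨i₁, hi₁⟩ := hne
    exact fun h ↦ hi₁ (congrFun h i₁)
  obtain ⟨i₀, hci₀, hmem⟩ := exists_div_mem O hc0
  let c' : Fin n → O := fun i ↦ ⟨(c i₀)⁻¹ * c i, hmem i⟩
  have hc'i₀ : c' i₀ = 1 := Subtype.ext (inv_mul_cancel₀ hci₀)
  have hrel : ∑ i, c' i • t i = 0 := by
    funext j
    apply Subtype.ext
    have h := congrArg (fun v : Fin r → C ↦ (c i₀)⁻¹ * v j) hc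
    simp only [Finset.sum_apply, Pi.smul_apply, smul_eq_mul, Pi.zero_apply] at h ⊢
    push_cast
    rw [mul_zero, Finset.mul_sum] at h
    rw [← h]
    refine Finset.sum_congr rfl fun i _ ↦ ?_
    simp only [c']
    ring
  have h0 := (Fintype.linearIndependent_iff.mp
    (linearIndependent_of_linearIndependent_residue O hli)) c' hrel i₀
  rw [hc'i₀] at h0
  exact one_ne_zero h0

/-- **Saturation**: if the reductions of `t₁, …, t_n` are linearly independent, a combination
`∑ cᵢ tᵢ` all of whose coordinates lie in the maximal ideal has all `cᵢ` in the maximal ideal. [folklore] -/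
theorem mem_maximalIdeal_of_forall_sum_mem {n : ℕ} {t : Fin n → Fin r → O}
    (hli : LinearIndependent (ResidueField O) (fun i j ↦ residue O (t i j)))
    {c : Fin n → O} (hc : ∀ j, (∑ i, c i • t i) j ∈ maximalIdeal O) (i : Fin n) :
    c i ∈ maximalIdeal O := by
  have hred : ∑ i, residue O (c i) • (fun j ↦ residue O (t i j)) = 0 := by
    funext j
    have h := (residue_eq_zero_iff _).mpr (hc j)
    simp only [Finset.sum_apply, Pi.smul_apply, smul_eq_mul, map_sum, map_mul] at h
    simpa [Finset.sum_apply] using h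
  have h := (Fintype.linearIndependent_iff.mp hli) _ hred i
  exact (residue_eq_zero_iff _).mp h

end Literature.LinearAlgebra
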